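import Summits.QuantumAdvantage.QuantumAdvantage.Theorems.HintDialClosure
import Summits.QuantumAdvantage.QuantumAdvantage.Theses.AnfPresentation
import Summits.QuantumAdvantage.QuantumAdvantage.Theses.TrustDial

/-!
# HintDialTable — module 7/10 of the HintDial THEOREMS package (cell decomp-qadv, lens-3 generation 6)

§5–§7: odd-characteristic and `AC⁰` rows, levels `≥ 3`, the split `RungA ↔ HintRung 2 ∧ (HintRung 2 → HintRung 1)` fed into the TREE's `AnfPresentation.closes`, the `(class × level)` table, and the TrustDial record proved BY NAME (items 29977 / 29978 / 29980).

Provenance: split of the farm-checked single file `HintDialTheorems.lean` (HOME/decomp-qadv-lens-3/g6/tree/; rc 0 · no proof holes ·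
axioms ⊆ {propext, Classical.choice, Quot.sound}); mathematical record: HOME/decomp-qadv-lens-3/g6/NODE-g6.md.  Modules in order:
HintDialDuality → HintDialLevels → HintDialAutomaton → HintDialLeakLaw → HintDialPlanting → HintDialClosure → HintDialTable → HintDialLowDegree → HintDialAnfLadder → HintDialCovariance (each imports its predecessor).  Namespace `Summit.QuantumAdvantage.QuantumAdvantage.Theorems.HintDial`.
-/

set_option linter.dupNamespace false

noncomputable section

namespace Summit.QuantumAdvantage.QuantumAdvantage.Theorems.HintDial

open Summit.QuantumAdvantage.QuantumAdvantage.Theses.AnfPresentation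
  (RungA LiftA NearExactIsExact SignedExactSliceIsLift AnfEquiv RungANonuniform)

open Finset
open Literature.Computability.Complexity
open Literature.Computability.QuantumComplexity
open Literature.Computability.MetaComplexity
open _root_.Computability (encodeNat)
/-! ## §5′ The route items are the TREE's (`open … Theses.AnfPresentation (RungA …)` above) -/

/-- HintDial helper `rungA_of_rungANonuniform` (lens-3 g6 HintDial THEOREMS package; see the enclosing section docstring). -/
theorem rungA_of_rungANonuniform : RungANonuniform → RungA :=
  fun h hA => h (promiseLift_mono Set.inter_subset_left hA)

/-- ★★ `RungA ⟺ HintRung 1` (the node's single EQUIV read on the blocker's class). -/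
theorem rungA_iff_hintRung_one : RungA ↔ HintRung 1 := (hintRungIn_one_iff _).symm

/-- HintDial helper `rungANonuniform_iff_hintRungNU_one` (lens-3 g6 HintDial THEOREMS package; see the enclosing section docstring). -/
theorem rungANonuniform_iff_hintRungNU_one : RungANonuniform ↔ HintRungNU 1 := (hintRungIn_one_iff _).symm

/-- HintDial helper `rungA_iff_trustForm_true` (lens-3 g6 HintDial THEOREMS package; see the enclosing section docstring). -/
theorem rungA_iff_trustForm_true : RungA ↔ trustForm (fun _ _ _ => True) ∉ promiseLift (AC0Mod 2 ∩ Classes.P) := by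
  rw [rungA_iff_hintRung_one, HintRung, HintRungIn, hintSlice_one_eq_trustForm]

/-! ## §5a ★★ THE ODD-CHARACTERISTIC CLOSURE (NEW, g6): at every hint level `k ≥ 1` and for every ODD prime `p` the dial is DECIDED —
`HintSlice k ∉ promiseLift AC⁰[p]` (hence `∉ promiseLift (AC⁰[p] ∩ P)`): RungA's analogue holds in every odd characteristic, so the
blocker is EXACTLY the characteristic-`2` cell. -/

/-- ★★ PROVED: `SignedExactCubicSliceANF ∉ promiseLift (AC⁰[p] ∩ P)` for every odd prime `p` — RungA with `⊕` replaced by `MOD_p`. -/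
theorem rungA_oddChar {p : ℕ} (hp : p.Prime) (hp2 : p ≠ 2) :
    SignedExactCubicSliceANF ∉ promiseLift (AC0Mod p ∩ Classes.P) :=
  fun h => Automaton.signedExact_not_AC0Mod_odd hp hp2 (promiseLift_mono Set.inter_subset_left h)

/-- ★★ PROVED: every hint level `k ≥ 1` is outside `promiseLift AC⁰[p]`, `p` odd. -/
theorem hintRungIn_oddChar {p : ℕ} (hp : p.Prime) (hp2 : p ≠ 2) {k : ℕ} (hk : 1 ≤ k) : HintRungIn (AC0Mod p) k :=
  hintRungIn_mono _ hk ((hintRungIn_one_iff _).2 (Automaton.signedExact_not_AC0Mod_odd hp hp2))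

/-- HintDial helper `hintRungIn_oddChar_P` (lens-3 g6 HintDial THEOREMS package; see the enclosing section docstring). -/
theorem hintRungIn_oddChar_P {p : ℕ} (hp : p.Prime) (hp2 : p ≠ 2) {k : ℕ} (hk : 1 ≤ k) : HintRungIn (AC0Mod p ∩ Classes.P) k :=
  hintRungIn_mono _ hk ((hintRungIn_one_iff _).2 (rungA_oddChar hp hp2))

/-- ★★ PROVED (plain `AC⁰` row): the exact slice is outside `promiseLift AC⁰` UNCONDITIONALLY (`AC⁰ ⊆ AC⁰[3]` + the odd closure) —
RungA with the `⊕` gates removed is a theorem; the blocker is precisely the parity gate. -/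
theorem signedExact_not_AC0 : SignedExactCubicSliceANF ∉ promiseLift AC0 :=
  fun h => Automaton.signedExact_not_AC0Mod_odd Nat.prime_three (by decide) (promiseLift_mono (AC0_subset_AC0Mod 3) h)

/-- HintDial helper `rungA_AC0` (lens-3 g6 HintDial THEOREMS package; see the enclosing section docstring). -/
theorem rungA_AC0 : SignedExactCubicSliceANF ∉ promiseLift (AC0 ∩ Classes.P) :=
  fun h => signedExact_not_AC0 (promiseLift_mono Set.inter_subset_left h)

/-- HintDial helper `hintRungIn_AC0` (lens-3 g6 HintDial THEOREMS package; see the enclosing section docstring). -/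
theorem hintRungIn_AC0 {k : ℕ} (hk : 1 ≤ k) : HintRungIn AC0 k :=
  hintRungIn_mono _ hk ((hintRungIn_one_iff _).2 signedExact_not_AC0)


/-! ## §5 ★★ THE PROVED DIAL POINTS: hint levels `≥ 3` are hard for (non-uniform) `AC⁰[⊕]` -/

/-- ★★ PROVED: `HintSlice 3 ∉ promiseLift AC⁰[⊕]` — the dual bit of a bent cubic(=quadratic MM) function, given `F` and only
the cubic part of the dual (here: nothing), is `MOD₃`-hard under literal projections. -/
theorem hintRungNU_three : HintRungNU 3 :=
  Automaton.not_promiseLift_AC0Mod2_of_planted (HintSlice 3) (fun _ w h => Automaton.inst_mem_yes w h)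
    (fun _ w h => Automaton.inst_mem_no w h)

/-- ★★ PROVED: every level `k ≥ 3` of the non-uniform dial. -/
theorem hintRungNU_of_three_le {k : ℕ} (hk : 3 ≤ k) : HintRungNU k := hintRungNU_mono hk hintRungNU_three

/-- ★★ PROVED dial point on the blocker's class: `HintRung 3`. -/
theorem hintRung_three : HintRung 3 := hintRung_of_NU 3 hintRungNU_three

/-- ★★ PROVED dial point: `HintRung 4` (the dual bit from `F` ALONE is hard for `AC⁰[⊕] ∩ P`). -/
theorem hintRung_four : HintRung 4 := hintRung_mono (by norm_num) hintRung_three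

/-- HintDial helper `hintRung_of_three_le` (lens-3 g6 HintDial THEOREMS package; see the enclosing section docstring). -/
theorem hintRung_of_three_le {k : ℕ} (hk : 3 ≤ k) : HintRung k := hintRung_mono hk hintRung_three

/-! ## §6 ★ THE SPLIT BENEATH THE EQUIV and the deciding chain

`RungA ⟺ HintRung 1` (EQUIV, §3).  Beneath it: `HintRung 1 ⟹ HintRung 2 ⟹ HintRung 3 ⟹ HintRung 4`, the last two PROVED
(§5).  The OPEN dial point `HintRung 2` («given `F` and the quadratic + cubic part of its dual, the dual bit is hard for
`AC⁰[⊕] ∩ P`») is the WEAKER piece `W`; the residual is the one-notch lift `Lift21 : HintRung 2 → HintRung 1`; and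
`RungA ⟺ W ∧ Lift21` (`rungA_iff_split`). -/

/-- `W` is NECESSARY for the blocker (`RungA → W2`): PROVED. -/
theorem w2_of_rungA : RungA → HintRung 2 := fun h => hintRung_mono one_le_two (rungA_iff_hintRung_one.1 h)


/-- ★★ THE SPLIT: `RungA ⟺ W2 ∧ Lift21`. -/
theorem rungA_iff_split : RungA ↔ (HintRung 2 ∧ (HintRung 2 → HintRung 1)) :=
  ⟨fun h => ⟨w2_of_rungA h, fun _ => rungA_iff_hintRung_one.1 h⟩,
    fun ⟨hW, hL⟩ => rungA_iff_hintRung_one.2 (hL hW)⟩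

/-- ★★ THE DECIDING CHAIN through the dial, fed into the TREE's `AnfPresentation.closes`:
`K2 → SliceIsLift → HintRung 2 → (HintRung 2 → HintRung 1) → LiftA → E_pres → QuantumAdvantage`. -/
theorem quantumAdvantage_of_dial (h₁ : NearExactIsExact) (h₂ : SignedExactSliceIsLift) (pW : HintRung 2)
    (pL : HintRung 2 → HintRung 1) (p₂ : LiftA) (hE : AnfEquiv) : QuantumAdvantage :=
  Summit.QuantumAdvantage.QuantumAdvantage.Theses.AnfPresentation.closes h₁ h₂ (rungA_iff_split.2 ⟨pW, pL⟩) p₂ hE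

/-- Summary of the dial (all PROVED): translation, monotonicity, the two settled notches, saturation. -/
theorem dial_summary :
    (RungA ↔ HintRung 1) ∧ (RungANonuniform ↔ HintRungNU 1) ∧ (∀ k k', k ≤ k' → HintRung k → HintRung k') ∧
      HintRung 3 ∧ HintRung 4 ∧ (∀ k, 3 ≤ k → HintRungNU k) ∧ (∀ k, (HintSlice k).Disjoint) ∧
      (∀ k, 4 ≤ k → HintSlice k = HintSlice 4) :=
  ⟨rungA_iff_hintRung_one, rungANonuniform_iff_hintRungNU_one, fun _ _ hk => hintRung_mono hk, hintRung_three, hintRung_four,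
    fun _ hk => hintRungNU_of_three_le hk, hintSlice_disjoint, fun _ hk => hintSlice_of_four_le hk⟩

/-- ★★★ THE (GATE-CLASS × HINT-LEVEL) TABLE of the dial `HintRungIn C k` ("`HintSlice k ∉ promiseLift C`"), every cell DECIDED except
the two characteristic-`2` cells `(AC⁰[⊕] (∩ P), 1) = RungA` and `(AC⁰[⊕] (∩ P), 2) = W2`, which are chained `RungA ⟺ W2 ∧ Lift21`:
* rows `AC⁰`, `AC⁰[p]`, `AC⁰[p] ∩ P` (`p` an odd prime): PROVED at every level `k ≥ 1` (parity planting, §4/§5a);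
* rows `AC⁰[⊕]`, `AC⁰[⊕] ∩ P`: PROVED at every level `k ≥ 3` (`MOD₃` planting, §4/§5); level `2` = `W2` (OPEN, W-piece), level `1` = RungA. -/
theorem dial_table :
    (∀ k, 1 ≤ k → HintRungIn AC0 k) ∧
    (∀ p, p.Prime → p ≠ 2 → ∀ k, 1 ≤ k → HintRungIn (AC0Mod p) k ∧ HintRungIn (AC0Mod p ∩ Classes.P) k) ∧
    (∀ k, 3 ≤ k → HintRungIn (AC0Mod 2) k ∧ HintRungIn (AC0Mod 2 ∩ Classes.P) k) ∧
    (HintRungIn (AC0Mod 2 ∩ Classes.P) 2 ↔ HintRung 2) ∧ (HintRungIn (AC0Mod 2 ∩ Classes.P) 1 ↔ RungA) ∧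
      (RungA ↔ HintRung 2 ∧ (HintRung 2 → HintRung 1)) :=
  ⟨fun _ hk => hintRungIn_AC0 hk, fun _ hp hp2 _ hk => ⟨hintRungIn_oddChar hp hp2 hk, hintRungIn_oddChar_P hp hp2 hk⟩,
    fun _ hk => ⟨hintRungNU_of_three_le hk, hintRung_of_three_le hk⟩, Iff.rfl, rungA_iff_hintRung_one.symm, rungA_iff_split⟩


/-! ## §7 ★ The generation-4 record (route `TrustDial`), PROVED BY NAME from the dial

Levels 4 / 3 / 2 of the dial are `TrustDial`'s strata ⊥ / cubic / mod-affine (`hintSlice_four/three/two_eq_trustForm`); one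
anti-monotonicity lemma in the agreement clause (`trustCl_anti`) yields every order record. -/

section TrustDialRecord

open Summit.QuantumAdvantage.QuantumAdvantage.Theses.TrustDial (SoloRung CubicPartRung ModAffineRung PolarRung PolarLift DialEdges)

/-- ★ tree item stmt-QuantumAdvantage-29977 `TrustDial.SoloRung` (= level 4 of the dial). -/
theorem trustDial_soloRung : SoloRung := by
  have h := hintRung_four
  rw [HintRung, HintRungIn, hintSlice_four_eq_trustForm, trustForm_false_eq] at h
  exact h

/-- ★ tree item stmt-QuantumAdvantage-29978 `TrustDial.CubicPartRung` (= level 3 of the dial, clause curried). -/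
theorem trustDial_cubicPartRung : CubicPartRung := by
  have h := hintRung_three
  rw [HintRung, HintRungIn, hintSlice_three_eq_trustForm, trustForm_eq_trustCl] at h
  exact trustCl_anti _
    (Cl' := fun G' G => ∀ i j l, i ≠ j → j ≠ l → i ≠ l → G'.cube i j l = G.cube i j l)
    (fun G' G hG i j l h₁ h₂ h₃ => hG i j l ⟨h₁, h₂, h₃⟩) h

/-- ★ `HintRung 2 ↔ TrustDial.ModAffineRung` (tree item stmt-QuantumAdvantage-29979 IS level 2 of the dial). -/
theorem hintRung_two_iff_modAffineRung : HintRung 2 ↔ ModAffineRung := by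
  rw [hintRung_two_iff_trustForm]; exact Iff.rfl

/-- HintDial helper `modAffineRung_of_rungA` (lens-3 g6 HintDial THEOREMS package; see the enclosing section docstring). -/
theorem modAffineRung_of_rungA : Summit.QuantumAdvantage.QuantumAdvantage.Theses.TrustDial.RungA → ModAffineRung :=
  fun h => hintRung_two_iff_modAffineRung.1 (w2_of_rungA h)

/-- HintDial helper `polarRung_of_modAffineRung` (lens-3 g6 HintDial THEOREMS package; see the enclosing section docstring). -/
theorem polarRung_of_modAffineRung : ModAffineRung → PolarRung := fun h =>
  trustCl_anti _
    (Cl := fun G' G => ∀ i j l, ¬ (i = j ∧ j = l) → G'.cube i j l = G.cube i j l)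
    (Cl' := fun G' G => ∀ i j l, ¬ (i = j ∧ j = l) → ¬ (i ≠ j ∧ j ≠ l ∧ i ≠ l) → G'.cube i j l = G.cube i j l)
    (fun _ _ hG i j l h₁ _ => hG i j l h₁) h

/-- HintDial helper `cubicPartRung_of_modAffineRung` (lens-3 g6 HintDial THEOREMS package; see the enclosing section docstring). -/
theorem cubicPartRung_of_modAffineRung : ModAffineRung → CubicPartRung := fun h =>
  trustCl_anti _
    (Cl := fun G' G => ∀ i j l, ¬ (i = j ∧ j = l) → G'.cube i j l = G.cube i j l)
    (Cl' := fun G' G => ∀ i j l, i ≠ j → j ≠ l → i ≠ l → G'.cube i j l = G.cube i j l)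
    (fun _ _ hG i j l h₁ _ _ => hG i j l (fun hc => h₁ hc.1)) h

/-- HintDial helper `soloRung_of_polarRung` (lens-3 g6 HintDial THEOREMS package; see the enclosing section docstring). -/
theorem soloRung_of_polarRung : PolarRung → SoloRung := fun _ => trustDial_soloRung

/-- ★ tree item stmt-QuantumAdvantage-29980 `TrustDial.DialEdges` — all five clauses. -/
theorem trustDial_dialEdges : DialEdges :=
  ⟨modAffineRung_of_rungA, polarRung_of_modAffineRung, cubicPartRung_of_modAffineRung, soloRung_of_polarRung,
   fun h => ⟨polarRung_of_modAffineRung (modAffineRung_of_rungA h), fun _ => h⟩, fun ⟨w, ℓ⟩ => ℓ w⟩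

/-- g4's W-piece sits BELOW level 2: `HintRung 2 → TrustDial.PolarRung`. -/
theorem polarRung_of_hintRung_two : HintRung 2 → PolarRung :=
  fun h => polarRung_of_modAffineRung (hintRung_two_iff_modAffineRung.1 h)

end TrustDialRecord

end Summit.QuantumAdvantage.QuantumAdvantage.Theorems.HintDial

end
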